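import Literature.NumberTheory.LFunctions.CubicRayClassCharacterCount
import Mathlib.FieldTheory.Finite.Basic
import Mathlib.RingTheory.Ideal.Norm.AbsNorm
import HarnessLib

/-!
# Generators of the units modulo `𝔪₀ = (∏_{v ∈ T, v ∤ 3} 𝔭_v) · 9`

`Proofs` file (theorems only), topic `Literature/NumberTheory/LFunctions`, the input `hgen` of
`CubicRayClassCharacterCount.ncard_cubicRayClassFunctions_le` (refined for quadratic base fields in
`CubicRayClassGeneratorsQuadratic.lean`): for a number field `K` and a finite set
`T` of primes containing the primes above `3`, there is a finite set `S ⊆ 𝓞_K` of integers prime to `T`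
with `#S ≤ #(𝓞_K/9) + #{v ∈ T : v ∤ 3}` such that every integer prime to `T` is congruent to a monomial
in `S` modulo `𝔪₀` (`exists_generators_baseModulus`): one generator of the cyclic group `(𝓞_K/𝔭_v)ˣ`
for each `v ∈ T`, `v ∤ 3`, lifted by the Chinese remainder theorem to be `≡ 1` at the other primes of `T`
and modulo `9`, together with a system of representatives of the units modulo `9`.  (Elementary:
`(𝓞_K/𝔪₀)ˣ ≅ ∏_{v ∤ 3} (𝓞_K/𝔭_v)ˣ × (𝓞_K/9)ˣ`; this is the count of the conductor part in the bound
`ω(q) + r₃ + O(1)` for the `3`-rank of a ray/ring class group, Belabas–Bhargava–Pomerance 2010, proof of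
Lemma 3.3, in the case of base field `ℚ` or of generators indexed by primes of `K`; the refinement for
quadratic `K` with rational integers killed is `exists_generators_baseModulus_quadratic` below.)

## References

* K. Belabas, M. Bhargava, C. Pomerance, *Error estimates for the Davenport–Heilbronn theorems*, Duke
  Math. J. 153 (2010), proof of Lemma 3.3 [BelabasBhargavaPomerance2010].
* J. Neukirch, *Algebraic Number Theory*, Ch. I §3 (Chinese remainder theorem), Ch. VI §1 [NeukirchANT1999].
-/

noncomputable section

open IsDedekindDomain IsDedekindDomain.HeightOneSpectrum NumberField Finset
open scoped nonZeroDivisors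

namespace Literature.NumberTheory.LFunctions

variable {K : Type*} [Field K] [NumberField K]

/-! ### The factorisation of `(9)` and of `𝔪₀` over `T` -/

omit [NumberField K] in
/-- `(9) ⊆ 𝔭 ↔ 3 ∈ 𝔭`. [folklore] -/
theorem span_nine_le_iff (v : HeightOneSpectrum (𝓞 K)) :
    Ideal.span {(9 : 𝓞 K)} ≤ v.asIdeal ↔ (3 : 𝓞 K) ∈ v.asIdeal := by
  rw [Ideal.span_singleton_le_iff_mem, show (9 : 𝓞 K) = 3 ^ 2 by norm_num]
  exact ⟨fun h => v.isPrime.mem_of_pow_mem 2 h, fun h => Ideal.pow_mem_of_mem _ h 2 two_pos⟩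

/-- The multiplicity of `𝔭` in `(9)` vanishes iff `3 ∉ 𝔭`. [folklore] -/
theorem count_span_nine_eq_zero_iff (v : HeightOneSpectrum (𝓞 K)) :
    (Associates.mk v.asIdeal).count (Associates.mk (Ideal.span {(9 : 𝓞 K)})).factors = 0 ↔
      (3 : 𝓞 K) ∉ v.asIdeal := by
  have h9 : Ideal.span {(9 : 𝓞 K)} ≠ ⊥ := by
    rw [Ne, Ideal.span_singleton_eq_bot]; norm_num
  rw [← span_nine_le_iff, ← Ideal.dvd_iff_le, ← Associates.count_ne_zero_iff_dvd h9 v.irreducible, not_not]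

/-- **`(9) = ∏_{v ∈ T} 𝔭_v^{c_v}`** with `c_v` the multiplicity of `𝔭_v` in `(9)`, for any finite `T`
containing the primes above `3`. [folklore] -/
theorem span_nine_eq_prod (T : Finset (HeightOneSpectrum (𝓞 K)))
    (hT3 : ∀ v : HeightOneSpectrum (𝓞 K), (3 : 𝓞 K) ∈ v.asIdeal → v ∈ T) :
    Ideal.span {(9 : 𝓞 K)} = ∏ v ∈ T, v.asIdeal ^
      (Associates.mk v.asIdeal).count (Associates.mk (Ideal.span {(9 : 𝓞 K)})).factors := by
  have h9 : Ideal.span {(9 : 𝓞 K)} ≠ ⊥ := by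
    rw [Ne, Ideal.span_singleton_eq_bot]; norm_num
  rw [← finprod_eq_prod_of_mulSupport_subset (fun v : HeightOneSpectrum (𝓞 K) => v.asIdeal ^
      (Associates.mk v.asIdeal).count (Associates.mk (Ideal.span {(9 : 𝓞 K)})).factors) (s := T) ?_]
  · exact (Ideal.finprod_heightOneSpectrum_factorization h9).symm
  · intro v hv
    rw [Function.mem_mulSupport] at hv
    refine hT3 v (not_not.mp ((count_span_nine_eq_zero_iff v).not.mp fun h0 => hv ?_))
    rw [h0, pow_zero]

/-- Membership in `(9)` is decided at the primes above `3`. [folklore] -/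
theorem mem_span_nine_iff (T : Finset (HeightOneSpectrum (𝓞 K)))
    (hT3 : ∀ v : HeightOneSpectrum (𝓞 K), (3 : 𝓞 K) ∈ v.asIdeal → v ∈ T) (y : 𝓞 K) :
    y ∈ Ideal.span {(9 : 𝓞 K)} ↔ ∀ v ∈ T, (3 : 𝓞 K) ∈ v.asIdeal → y ∈ v.asIdeal ^
      (Associates.mk v.asIdeal).count (Associates.mk (Ideal.span {(9 : 𝓞 K)})).factors := by
  set c : HeightOneSpectrum (𝓞 K) → ℕ := fun v =>
    (Associates.mk v.asIdeal).count (Associates.mk (Ideal.span {(9 : 𝓞 K)})).factors with hc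
  have hinf := HeightOneSpectrum.inf_pow_eq_prod T c (fun v => v) fun v _ w _ h => h
  have h9 : Ideal.span {(9 : 𝓞 K)} = ∏ v ∈ T, v.asIdeal ^ c v := span_nine_eq_prod T hT3
  show y ∈ Ideal.span {(9 : 𝓞 K)} ↔ ∀ v ∈ T, (3 : 𝓞 K) ∈ v.asIdeal → y ∈ v.asIdeal ^ c v
  rw [h9, ← hinf, Submodule.mem_finsetInf]
  refine forall₂_congr fun v hv => ⟨fun h _ => h, fun h => ?_⟩
  by_cases hv3 : (3 : 𝓞 K) ∈ v.asIdeal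
  · exact h hv3
  · rw [show c v = 0 from (count_span_nine_eq_zero_iff v).mpr hv3, pow_zero, Ideal.one_eq_top]
    exact Submodule.mem_top

open scoped Classical in
/-- **`𝔪₀ = ∏_{v ∈ T} 𝔭_v^{e_v}`** with `e_v = 1` for `v ∤ 3` and `e_v = c_v` (multiplicity in `(9)`) for
`v ∣ 3`. [folklore] -/
theorem baseModulus_eq_prod (T : Finset (HeightOneSpectrum (𝓞 K)))
    (hT3 : ∀ v : HeightOneSpectrum (𝓞 K), (3 : 𝓞 K) ∈ v.asIdeal → v ∈ T) :
    (∏ v ∈ T.filter (fun v => (3 : 𝓞 K) ∉ v.asIdeal), v.asIdeal) * Ideal.span {(9 : 𝓞 K)} =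
      ∏ v ∈ T, v.asIdeal ^ (if (3 : 𝓞 K) ∈ v.asIdeal then
        (Associates.mk v.asIdeal).count (Associates.mk (Ideal.span {(9 : 𝓞 K)})).factors else 1) := by
  set c : HeightOneSpectrum (𝓞 K) → ℕ := fun v =>
    (Associates.mk v.asIdeal).count (Associates.mk (Ideal.span {(9 : 𝓞 K)})).factors with hc
  have h9 : Ideal.span {(9 : 𝓞 K)} = ∏ v ∈ T, v.asIdeal ^ c v := span_nine_eq_prod T hT3
  show (∏ v ∈ T.filter (fun v => (3 : 𝓞 K) ∉ v.asIdeal), v.asIdeal) * Ideal.span {(9 : 𝓞 K)} =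
    ∏ v ∈ T, v.asIdeal ^ (if (3 : 𝓞 K) ∈ v.asIdeal then c v else 1)
  rw [h9, Finset.prod_filter, ← Finset.prod_mul_distrib]
  refine Finset.prod_congr rfl fun v _ => ?_
  by_cases hv3 : (3 : 𝓞 K) ∈ v.asIdeal
  · simp [hv3]
  · rw [if_pos hv3, if_neg hv3, show c v = 0 from (count_span_nine_eq_zero_iff v).mpr hv3, pow_zero,
      mul_one, pow_one]

open scoped Classical in
/-- **Membership in `𝔪₀` is decided componentwise** at the primes of `T`. [folklore] -/
theorem mem_baseModulus_iff (T : Finset (HeightOneSpectrum (𝓞 K)))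
    (hT3 : ∀ v : HeightOneSpectrum (𝓞 K), (3 : 𝓞 K) ∈ v.asIdeal → v ∈ T) (y : 𝓞 K) :
    y ∈ (∏ v ∈ T.filter (fun v => (3 : 𝓞 K) ∉ v.asIdeal), v.asIdeal) * Ideal.span {(9 : 𝓞 K)} ↔
      ∀ v ∈ T, y ∈ v.asIdeal ^ (if (3 : 𝓞 K) ∈ v.asIdeal then
        (Associates.mk v.asIdeal).count (Associates.mk (Ideal.span {(9 : 𝓞 K)})).factors else 1) := by
  set e : HeightOneSpectrum (𝓞 K) → ℕ := fun v => if (3 : 𝓞 K) ∈ v.asIdeal then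
    (Associates.mk v.asIdeal).count (Associates.mk (Ideal.span {(9 : 𝓞 K)})).factors else 1 with he
  have hinf := HeightOneSpectrum.inf_pow_eq_prod T e (fun v => v) fun v _ w _ h => h
  rw [baseModulus_eq_prod T hT3, ← hinf, Submodule.mem_finsetInf]

open scoped Classical in
/-- A sufficient componentwise criterion: `≡ 0 mod 𝔭_v` for `v ∤ 3` in `T` and `≡ 0 mod 9`. [folklore] -/
theorem mem_baseModulus_of (T : Finset (HeightOneSpectrum (𝓞 K)))
    (hT3 : ∀ v : HeightOneSpectrum (𝓞 K), (3 : 𝓞 K) ∈ v.asIdeal → v ∈ T) {y : 𝓞 K}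
    (h1 : ∀ v ∈ T, (3 : 𝓞 K) ∉ v.asIdeal → y ∈ v.asIdeal) (h9 : y ∈ Ideal.span {(9 : 𝓞 K)}) :
    y ∈ (∏ v ∈ T.filter (fun v => (3 : 𝓞 K) ∉ v.asIdeal), v.asIdeal) * Ideal.span {(9 : 𝓞 K)} := by
  classical
  rw [mem_baseModulus_iff T hT3]
  intro v hv
  by_cases hv3 : (3 : 𝓞 K) ∈ v.asIdeal
  · rw [if_pos hv3]
    exact (mem_span_nine_iff T hT3 y).mp h9 v hv hv3
  · rw [if_neg hv3, pow_one]
    exact h1 v hv hv3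

/-! ### Chinese remainder lifts and generators of the residue fields -/

omit [NumberField K] in
/-- `a ≡ b mod I ⇒ aⁿ ≡ bⁿ mod I`. [folklore] -/
theorem sub_pow_mem_of_sub_mem {I : Ideal (𝓞 K)} {a b : 𝓞 K} (h : a - b ∈ I) (n : ℕ) :
    a ^ n - b ^ n ∈ I := by
  obtain ⟨q, hq⟩ := sub_dvd_pow_sub_pow a b n
  rw [hq]
  exact I.mul_mem_right _ h

omit [NumberField K] in
/-- `a ≡ 1 mod I ⇒ aⁿ ≡ 1 mod I`. [folklore] -/
theorem sub_one_pow_mem_of_sub_one_mem {I : Ideal (𝓞 K)} {a : 𝓞 K} (h : a - 1 ∈ I) (n : ℕ) :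
    a ^ n - 1 ∈ I := by
  simpa using sub_pow_mem_of_sub_mem h n

/-- **Chinese remainder theorem on `T`**: prescribed residues modulo `𝔭_v^{e_v}`, `v ∈ T`. [folklore] -/
theorem exists_forall_sub_mem_pow (T : Finset (HeightOneSpectrum (𝓞 K))) (e : HeightOneSpectrum (𝓞 K) → ℕ)
    (t : HeightOneSpectrum (𝓞 K) → 𝓞 K) : ∃ y : 𝓞 K, ∀ v ∈ T, y - t v ∈ v.asIdeal ^ e v := by
  obtain ⟨y, hy⟩ := IsDedekindDomain.exists_forall_sub_mem_ideal (fun v : HeightOneSpectrum (𝓞 K) => v.asIdeal) e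
    (fun v _ => v.prime) (fun v _ w _ h => fun h' => h (HeightOneSpectrum.ext h')) (fun v : T => t v)
  exact ⟨y, fun v hv => hy v hv⟩

/-- **A generator of `(𝓞_K/𝔭)ˣ`**: every integer not in `𝔭` is congruent to a power of a fixed `g ∉ 𝔭`
(the unit group of the finite field `𝓞_K/𝔭` is cyclic). [folklore] -/
theorem exists_generator_mod (v : HeightOneSpectrum (𝓞 K)) :
    ∃ g : 𝓞 K, g ∉ v.asIdeal ∧ ∀ x : 𝓞 K, x ∉ v.asIdeal → ∃ n : ℕ, x - g ^ n ∈ v.asIdeal := by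
  classical
  haveI := v.isMaximal
  letI : Field (𝓞 K ⧸ v.asIdeal) := Ideal.Quotient.field v.asIdeal
  haveI : Finite (𝓞 K ⧸ v.asIdeal) := Ideal.finiteQuotientOfFreeOfNeBot v.asIdeal v.ne_bot
  obtain ⟨γ, hγ⟩ := IsCyclic.exists_generator (α := (𝓞 K ⧸ v.asIdeal)ˣ)
  obtain ⟨g, hg⟩ := Ideal.Quotient.mk_surjective (γ : 𝓞 K ⧸ v.asIdeal)
  refine ⟨g, fun h => γ.ne_zero (by rw [← hg, Ideal.Quotient.eq_zero_iff_mem]; exact h), fun x hx => ?_⟩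
  have hx0 : Ideal.Quotient.mk v.asIdeal x ≠ 0 := by
    rw [Ne, Ideal.Quotient.eq_zero_iff_mem]; exact hx
  have hmem : Units.mk0 _ hx0 ∈ Submonoid.powers γ := by
    rw [mem_powers_iff_mem_zpowers]; exact hγ _
  obtain ⟨n, hn⟩ := hmem
  refine ⟨n, ?_⟩
  rw [← Ideal.Quotient.eq, map_pow, hg]
  have := congrArg (fun u : (𝓞 K ⧸ v.asIdeal)ˣ => (u : 𝓞 K ⧸ v.asIdeal)) hn
  simpa using this.symm

omit [NumberField K] in
/-- **Rewriting a monomial over a finite set**: a product `∏_{i ∈ I} φ(i)^{m_i}` with values in `S` is a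
monomial `∏_{s ∈ S} s^{n_s}`. [folklore] -/
theorem exists_prod_pow_eq {ι : Type*} (I : Finset ι) (φ : ι → 𝓞 K) (m : ι → ℕ) (S : Finset (𝓞 K))
    (h : ∀ i ∈ I, φ i ∈ S) : ∃ n : 𝓞 K → ℕ, ∏ i ∈ I, φ i ^ m i = ∏ s ∈ S, s ^ n s := by
  classical
  refine ⟨fun s => ∑ i ∈ I.filter (fun i => φ i = s), m i, ?_⟩
  rw [← Finset.prod_fiberwise_of_maps_to h]
  refine Finset.prod_congr rfl fun s _ => ?_
  rw [← Finset.prod_pow_eq_pow_sum]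
  exact Finset.prod_congr rfl fun i hi => by rw [(Finset.mem_filter.mp hi).2]

/-! ### Representatives modulo `9` -/

open scoped Classical in
/-- **Representatives of the units modulo `9`, trivial at the other primes of `T`**: a set `S₉` of at
most `#(𝓞_K/9)` integers, each prime to `T` and `≡ 1 mod 𝔭_v` for `v ∈ T`, `v ∤ 3`, such that every
integer prime to `T` is congruent modulo `9` to an element of `S₉`. [folklore] -/
theorem exists_nine_representatives (T : Finset (HeightOneSpectrum (𝓞 K)))
    (hT3 : ∀ v : HeightOneSpectrum (𝓞 K), (3 : 𝓞 K) ∈ v.asIdeal → v ∈ T) :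
    ∃ S₉ : Finset (𝓞 K), S₉.card ≤ Nat.card (𝓞 K ⧸ Ideal.span {(9 : 𝓞 K)}) ∧
      (∀ s ∈ S₉, ∀ v ∈ T, s ∉ v.asIdeal) ∧
      (∀ s ∈ S₉, ∀ v ∈ T, (3 : 𝓞 K) ∉ v.asIdeal → s - 1 ∈ v.asIdeal) ∧
      ∀ u : 𝓞 K, (∀ v ∈ T, u ∉ v.asIdeal) → ∃ s ∈ S₉, u - s ∈ Ideal.span {(9 : 𝓞 K)} := by
  set N : Ideal (𝓞 K) := Ideal.span {(9 : 𝓞 K)} with hN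
  have hN0 : N ≠ ⊥ := by rw [hN, Ne, Ideal.span_singleton_eq_bot]; norm_num
  haveI : Finite (𝓞 K ⧸ N) := Ideal.finiteQuotientOfFreeOfNeBot N hN0
  haveI : Fintype (𝓞 K ⧸ N) := Fintype.ofFinite _
  set c : HeightOneSpectrum (𝓞 K) → ℕ := fun v =>
    (Associates.mk v.asIdeal).count (Associates.mk (Ideal.span {(9 : 𝓞 K)})).factors with hc
  -- a representative of each class, and its CRT lift
  set rep : 𝓞 K ⧸ N → 𝓞 K := fun q => (Ideal.Quotient.mk_surjective q).choose with hrep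
  have hrep_spec : ∀ q, Ideal.Quotient.mk N (rep q) = q := fun q => (Ideal.Quotient.mk_surjective q).choose_spec
  have hlift : ∀ q : 𝓞 K ⧸ N, ∃ y : 𝓞 K, ∀ v ∈ T,
      y - (if (3 : 𝓞 K) ∈ v.asIdeal then rep q else 1) ∈ v.asIdeal ^ (if (3 : 𝓞 K) ∈ v.asIdeal then c v else 1) :=
    fun q => exists_forall_sub_mem_pow T _ _
  choose lift hlift using hlift
  set good : Finset (𝓞 K ⧸ N) := Finset.univ.filter fun q => ∀ v ∈ T, (3 : 𝓞 K) ∈ v.asIdeal → rep q ∉ v.asIdeal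
    with hgood
  refine ⟨good.image lift, ?_, ?_, ?_, ?_⟩
  · calc (good.image lift).card ≤ good.card := Finset.card_image_le
      _ ≤ (Finset.univ : Finset (𝓞 K ⧸ N)).card := Finset.card_le_card (Finset.filter_subset _ _)
      _ = Nat.card (𝓞 K ⧸ N) := by rw [Finset.card_univ, Nat.card_eq_fintype_card]
  · intro s hs v hv
    obtain ⟨q, hq, rfl⟩ := Finset.mem_image.mp hs
    have hq' := (Finset.mem_filter.mp hq).2
    have h := hlift q v hv
    by_cases hv3 : (3 : 𝓞 K) ∈ v.asIdeal
    · rw [if_pos hv3, if_pos hv3] at h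
      intro hmem
      have hc0 : c v ≠ 0 := fun h0 => (count_span_nine_eq_zero_iff v).mp h0 hv3
      have : rep q ∈ v.asIdeal := by
        have h' : lift q - rep q ∈ v.asIdeal := Ideal.pow_le_self hc0 h
        have : rep q = lift q - (lift q - rep q) := by ring
        rw [this]; exact v.asIdeal.sub_mem hmem h'
      exact hq' v hv hv3 this
    · rw [if_neg hv3, if_neg hv3, pow_one] at h
      intro hmem
      have : (1 : 𝓞 K) = lift q - (lift q - 1) := by ring
      exact v.isPrime.ne_top ((Ideal.eq_top_iff_one _).mpr (this ▸ v.asIdeal.sub_mem hmem h))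
  · intro s hs v hv hv3
    obtain ⟨q, -, rfl⟩ := Finset.mem_image.mp hs
    have h := hlift q v hv
    rwa [if_neg hv3, if_neg hv3, pow_one] at h
  · intro u hu
    set q := Ideal.Quotient.mk N u with hq
    have hqu : rep q - u ∈ N := by rw [← Ideal.Quotient.eq, hrep_spec]
    have hqgood : q ∈ good := by
      refine Finset.mem_filter.mpr ⟨Finset.mem_univ _, fun v hv hv3 hmem => hu v hv ?_⟩
      have : u = rep q - (rep q - u) := by ring
      rw [this]
      exact v.asIdeal.sub_mem hmem ((span_nine_le_iff v).mpr hv3 hqu)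
    refine ⟨lift q, Finset.mem_image_of_mem _ hqgood, ?_⟩
    have h9 : lift q - rep q ∈ N := by
      rw [hN, mem_span_nine_iff T hT3]
      intro v hv hv3
      have h := hlift q v hv
      rwa [if_pos hv3, if_pos hv3] at h
    have : u - lift q = -((lift q - rep q) + (rep q - u)) := by ring
    rw [this]
    exact N.neg_mem (N.add_mem h9 hqu)

/-! ### Generators: one per prime of `T` away from `3` -/

open scoped Classical in
/-- **Generators of `(𝓞_K/𝔪₀)ˣ`**: there is a finite set `S` of integers prime to `T` with
`#S ≤ #(𝓞_K/9) + #{v ∈ T : v ∤ 3}` such that every integer `x` prime to `T` satisfies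
`x ≡ ∏_{s ∈ S} s^{n_s} mod 𝔪₀ = (∏_{v ∈ T, v ∤ 3} 𝔭_v) · 9` for suitable exponents (a generator of each
cyclic `(𝓞_K/𝔭_v)ˣ`, `v ∤ 3`, lifted to be `≡ 1` elsewhere on `T` and modulo `9`, and representatives of
the units modulo `9`).  With `Z = {1}` this is the hypothesis `hgen` of `ncard_cubicRayClassFunctions_le`.
[cite: BelabasBhargavaPomerance2010, proof of Lemma 3.3] -/
theorem exists_generators_baseModulus (T : Finset (HeightOneSpectrum (𝓞 K)))
    (hT3 : ∀ v : HeightOneSpectrum (𝓞 K), (3 : 𝓞 K) ∈ v.asIdeal → v ∈ T) :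
    ∃ S : Finset (𝓞 K),
      S.card ≤ Nat.card (𝓞 K ⧸ Ideal.span {(9 : 𝓞 K)}) + (T.filter fun v => (3 : 𝓞 K) ∉ v.asIdeal).card ∧
      (∀ s ∈ S, ∀ v ∈ T, s ∉ v.asIdeal) ∧
      ∀ x : 𝓞 K, (∀ v ∈ T, x ∉ v.asIdeal) → ∃ n : 𝓞 K → ℕ,
        x - ∏ s ∈ S, s ^ n s ∈
          (∏ v ∈ T.filter (fun v => (3 : 𝓞 K) ∉ v.asIdeal), v.asIdeal) * Ideal.span {(9 : 𝓞 K)} := by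
  set T' := T.filter fun v => (3 : 𝓞 K) ∉ v.asIdeal with hT'
  set c : HeightOneSpectrum (𝓞 K) → ℕ := fun v =>
    (Associates.mk v.asIdeal).count (Associates.mk (Ideal.span {(9 : 𝓞 K)})).factors with hc
  obtain ⟨S₉, h9card, h9T, h9one, h9cov⟩ := exists_nine_representatives T hT3
  -- generators of the residue fields at `v ∈ T'`, lifted
  choose g hgv hgen using fun v : HeightOneSpectrum (𝓞 K) => exists_generator_mod v
  have hlift : ∀ v : HeightOneSpectrum (𝓞 K), ∃ y : 𝓞 K, ∀ w ∈ T,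
      y - (if w = v then g v else 1) ∈ w.asIdeal ^ (if (3 : 𝓞 K) ∈ w.asIdeal then c w else 1) :=
    fun v => exists_forall_sub_mem_pow T _ _
  choose sgen hsgen using hlift
  -- congruences of the lifted generators
  have hs_self : ∀ v ∈ T', sgen v - g v ∈ v.asIdeal := by
    intro v hv
    obtain ⟨hvT, hv3⟩ := Finset.mem_filter.mp hv
    have h := hsgen v v hvT
    rwa [if_pos rfl, if_neg hv3, pow_one] at h
  have hs_other : ∀ v w : HeightOneSpectrum (𝓞 K), w ∈ T → w ≠ v → (3 : 𝓞 K) ∉ w.asIdeal →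
      sgen v - 1 ∈ w.asIdeal := by
    intro v w hw hwv hw3
    have h := hsgen v w hw
    rwa [if_neg hwv, if_neg hw3, pow_one] at h
  have hs_nine : ∀ v ∈ T', sgen v - 1 ∈ Ideal.span {(9 : 𝓞 K)} := by
    intro v hv
    obtain ⟨-, hv3⟩ := Finset.mem_filter.mp hv
    rw [mem_span_nine_iff T hT3]
    intro w hw hw3
    have hwv : w ≠ v := fun h => hv3 (h ▸ hw3)
    have h := hsgen v w hw
    rwa [if_neg hwv, if_pos hw3] at h
  have hsT : ∀ v ∈ T', ∀ w ∈ T, sgen v ∉ w.asIdeal := by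
    intro v hv w hw hmem
    obtain ⟨-, hv3⟩ := Finset.mem_filter.mp hv
    by_cases hwv : w = v
    · subst hwv
      have : g w = sgen w - (sgen w - g w) := by ring
      exact hgv w (this ▸ w.asIdeal.sub_mem hmem (hs_self w hv))
    · have h1 : sgen v - 1 ∈ w.asIdeal := by
        by_cases hw3 : (3 : 𝓞 K) ∈ w.asIdeal
        · exact (span_nine_le_iff w).mpr hw3 (hs_nine v hv)
        · exact hs_other v w hw hwv hw3
      have : (1 : 𝓞 K) = sgen v - (sgen v - 1) := by ring
      exact w.isPrime.ne_top ((Ideal.eq_top_iff_one _).mpr (this ▸ w.asIdeal.sub_mem hmem h1))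
  refine ⟨S₉ ∪ T'.image sgen, ?_, ?_, ?_⟩
  · calc (S₉ ∪ T'.image sgen).card ≤ S₉.card + (T'.image sgen).card := Finset.card_union_le _ _
      _ ≤ Nat.card (𝓞 K ⧸ Ideal.span {(9 : 𝓞 K)}) + T'.card :=
        add_le_add h9card Finset.card_image_le
  · intro s hs w hw
    rcases Finset.mem_union.mp hs with hs | hs
    · exact h9T s hs w hw
    · obtain ⟨v, hv, rfl⟩ := Finset.mem_image.mp hs
      exact hsT v hv w hw
  · intro x hx
    -- exponents at the generators
    have hn : ∀ v : HeightOneSpectrum (𝓞 K), ∃ n : ℕ, v ∈ T' → x - g v ^ n ∈ v.asIdeal := by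
      intro v
      by_cases hv : v ∈ T'
      · obtain ⟨n, hn⟩ := hgen v x (hx v (Finset.mem_filter.mp hv).1)
        exact ⟨n, fun _ => hn⟩
      · exact ⟨0, fun h => absurd h hv⟩
    choose m hm using hn
    set P := ∏ v ∈ T', sgen v ^ m v with hP
    -- `P ≡ x mod 𝔭_w` for `w ∈ T'`, `P ≡ 1 mod 9`
    have hPw : ∀ w ∈ T', P - x ∈ w.asIdeal := by
      intro w hw
      have hwT : w ∈ T := (Finset.mem_filter.mp hw).1
      have hw3 : (3 : 𝓞 K) ∉ w.asIdeal := (Finset.mem_filter.mp hw).2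
      rw [hP, ← Finset.mul_prod_erase T' (fun v => sgen v ^ m v) hw]
      -- `∏_{v ≠ w} sgen v ^ m v ≡ 1`, `sgen w ^ m w ≡ g w ^ m w ≡ x`
      have h1 : (∏ v ∈ T'.erase w, sgen v ^ m v) - 1 ∈ w.asIdeal := by
        refine Finset.prod_induction _ (fun y => y - 1 ∈ w.asIdeal) ?_ (by simp) ?_
        · intro a b ha hb
          have : a * b - 1 = (a - 1) * b + (b - 1) := by ring
          rw [this]; exact w.asIdeal.add_mem (w.asIdeal.mul_mem_right _ ha) hb
        · intro v hv
          have hvw : v ≠ w := Finset.ne_of_mem_erase hv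
          refine sub_one_pow_mem_of_sub_one_mem (hs_other v w hwT hvw.symm hw3) _
      have h2 : sgen w ^ m w - g w ^ m w ∈ w.asIdeal := sub_pow_mem_of_sub_mem (hs_self w hw) _
      have h3 := hm w hw
      have : sgen w ^ m w * ∏ v ∈ T'.erase w, sgen v ^ m v - x =
          sgen w ^ m w * ((∏ v ∈ T'.erase w, sgen v ^ m v) - 1) + (sgen w ^ m w - g w ^ m w) - (x - g w ^ m w) := by
        ring
      rw [this]
      exact w.asIdeal.sub_mem (w.asIdeal.add_mem (w.asIdeal.mul_mem_left _ h1) h2) h3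
    have hP9 : P - 1 ∈ Ideal.span {(9 : 𝓞 K)} := by
      rw [hP]
      refine Finset.prod_induction _ (fun y => y - 1 ∈ Ideal.span {(9 : 𝓞 K)}) ?_ (by simp) ?_
      · intro a b ha hb
        have : a * b - 1 = (a - 1) * b + (b - 1) := by ring
        rw [this]; exact Ideal.add_mem _ (Ideal.mul_mem_right _ _ ha) hb
      · intro v hv
        exact sub_one_pow_mem_of_sub_one_mem (hs_nine v hv) _
    -- the representative modulo `9`
    obtain ⟨s, hs, hxs⟩ := h9cov x hx
    -- the monomial `P * s` over `S`
    obtain ⟨n₁, hn₁⟩ := exists_prod_pow_eq T' sgen m (S₉ ∪ T'.image sgen)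
      fun v hv => Finset.mem_union_right _ (Finset.mem_image_of_mem _ hv)
    obtain ⟨n₂, hn₂⟩ := exists_prod_pow_eq ({s} : Finset (𝓞 K)) id (fun _ => 1) (S₉ ∪ T'.image sgen)
      fun y hy => by rw [Finset.mem_singleton.mp hy]; exact Finset.mem_union_left _ hs
    refine ⟨fun y => n₁ y + n₂ y, ?_⟩
    have hprod : ∏ y ∈ S₉ ∪ T'.image sgen, y ^ (n₁ y + n₂ y) = P * s := by
      simp_rw [pow_add]
      rw [Finset.prod_mul_distrib, ← hn₁, ← hn₂, hP]
      simp
    rw [hprod]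
    refine mem_baseModulus_of T hT3 (fun w hw hw3 => ?_) ?_
    · have hw' : w ∈ T' := Finset.mem_filter.mpr ⟨hw, hw3⟩
      have : x - P * s = -((P - x) * s + x * (s - 1)) := by ring
      rw [this]
      exact w.asIdeal.neg_mem (w.asIdeal.add_mem (w.asIdeal.mul_mem_right _ (hPw w hw'))
        (w.asIdeal.mul_mem_left _ (h9one s hs w hw hw3)))
    · have : x - P * s = -((P - 1) * s + (s - x)) := by ring
      rw [this]
      refine Submodule.neg_mem _ (Ideal.add_mem _ (Ideal.mul_mem_right _ _ hP9) ?_)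
      have : s - x = -(x - s) := by ring
      rw [this]; exact Submodule.neg_mem _ hxs

end Literature.NumberTheory.LFunctions

end
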